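import Summits.Parity.GeneralizedHardyLittlewood.Theorems.PrimeLevelFamEdgeMomentsBeyondDiagonalDiagBoseB0Leading
import Summits.Parity.GeneralizedHardyLittlewood.Theorems.PrimeLevelFamEdgeMomentsBeyondDiagonalDiagBoseB0
import Summits.Parity.GeneralizedHardyLittlewood.Theorems.PrimeLevelFamEdgeMomentsBeyondDiagonalDiagBoseSymm
import HarnessLib

/-!
# Route `PrimeLevelFamEdge`, crux K_A `MomentsBeyondDiagonal` (stmt-Parity-20007), line «petersson_layers» v4, stub `stub_diag`:
# **census R2 for the Bose coefficients `c_{a0}` and `c_{0a}` in the two-dimensional form of `bose_expand`**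

`…DiagBoseOuter.bose_expand` (p812352) writes the line-series weight as
`𝔚_ij(A₁,A₂;y) = Σ_{a≤i,b≤j} C(i,a)C(j,b)A₁^{i−a}A₂^{j−b}·c_ab(y)` with the two-dimensional Bose coefficients
`c_ab(y) = ∫_{u₁>0}(log u₁)^a ∫_{u₂>y/u₁} e^{−(u₁+u₂)}(1−e^{−(u₁+u₂)})^{−2}(log u₂)^b`. This file transports the leading small-`y`
behaviour of the one-dimensional `c_{a0}` (`…DiagBoseB0Leading.bose_coeff_a0_leading`, p818171) to that form:

* `bose_coeff_a_zero_leading` — **`|c_{a0}(y) − (−1)^a(log(1/y)/2)^{a+1}/(a+1)| ≤ C_a(1+log(1/y))^a`** (`0 < y ≤ 1`), via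
  `…DiagBoseB0.bose_coeff_b_zero_eq`;
* `bose_coeff_zero_a_leading` — the same for `c_{0a}` (`…DiagBoseSymm.bose_coeff_symm`).
The mixed coefficients `c_ab`, `a, b ≥ 1` (kernel `1/φ² + O(1)`, `…DiagBoseKernel2`) remain.

Def-free; theorems only. Helper `--supports stmt-Parity-20007`; closes nothing; K_A, K_B and the Parity summit are NOT
proved; nothing about Landau–Siegel zeros.

## References
* E. Kowalski, P. Michel, J. VanderKam, J. reine angew. Math. 526 (2000), (22)–(28) pp. 12–15.
  [cite: KowalskiMichelVanderKam2000, (22)–(28) — derivation (residues of the diagonal weight)]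
-/

noncomputable section

open Real Set MeasureTheory

namespace Summit.Parity.GeneralizedHardyLittlewood.Theorems.MomentsBeyondDiagonal.DiagLines

/-- **R2 for `c_{a0}` (two-dimensional form).** For every `a` there is `C` with
`|∫_{u₁>0}(log u₁)^a∫_{u₂>y/u₁}B(u₁+u₂)(log u₂)^0 − (−1)^a(log(1/y)/2)^{a+1}/(a+1)| ≤ C(1+log(1/y))^a` for `0 < y ≤ 1`.
[cite: KowalskiMichelVanderKam2000, (22)–(28) — derivation (leading residue, coefficient c_{a0})] -/
theorem bose_coeff_a_zero_leading (a : ℕ) : ∃ C : ℝ, ∀ y : ℝ, 0 < y → y ≤ 1 →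
    |(∫ u₁ in Ioi (0 : ℝ), Real.log u₁ ^ a *
        ∫ u₂ in Ioi (y / u₁), Real.exp (-(u₁ + u₂)) / (1 - Real.exp (-(u₁ + u₂))) ^ 2 * Real.log u₂ ^ 0) -
        (-1) ^ a * (Real.log (1 / y) / 2) ^ (a + 1) / ((a : ℝ) + 1)| ≤ C * (1 + Real.log (1 / y)) ^ a := by
  obtain ⟨C, hC⟩ := bose_coeff_a0_leading a
  refine ⟨C, fun y hy0 hy1 ↦ ?_⟩
  rw [bose_coeff_b_zero_eq hy0 a]
  exact hC y hy0 hy1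

/-- **R2 for `c_{0a}` (two-dimensional form)**: the same bound for the coefficient with the log power on the inner
variable, by the symmetry `c_ab = c_ba`. [cite: KowalskiMichelVanderKam2000, (22)–(28) — derivation (leading residue, coefficient c_{0a})] -/
theorem bose_coeff_zero_a_leading (a : ℕ) : ∃ C : ℝ, ∀ y : ℝ, 0 < y → y ≤ 1 →
    |(∫ u₁ in Ioi (0 : ℝ), Real.log u₁ ^ 0 *
        ∫ u₂ in Ioi (y / u₁), Real.exp (-(u₁ + u₂)) / (1 - Real.exp (-(u₁ + u₂))) ^ 2 * Real.log u₂ ^ a) -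
        (-1) ^ a * (Real.log (1 / y) / 2) ^ (a + 1) / ((a : ℝ) + 1)| ≤ C * (1 + Real.log (1 / y)) ^ a := by
  obtain ⟨C, hC⟩ := bose_coeff_a_zero_leading a
  refine ⟨C, fun y hy0 hy1 ↦ ?_⟩
  rw [bose_coeff_symm hy0 0 a]
  exact hC y hy0 hy1

end Summit.Parity.GeneralizedHardyLittlewood.Theorems.MomentsBeyondDiagonal.DiagLines

end
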